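import Literature.AlgebraicGeometry.Motives.GeneratingSectionsOfIso
import Literature.AlgebraicGeometry.Motives.GeneratingSectionsFrameIndependence
import HarnessLib

/-!
# The generating-sections datum of `(𝓛, t)` sees neither the frames nor an isomorphism of `𝓛`

Layer `Literature/AlgebraicGeometry/Motives`, namespace `Literature.AlgebraicGeometry.Motives.GeneratingSections`; THEOREMS
ONLY (no `def`, no instance, no notation, no named fact, no `sorry`).  Cell `hodgecm-mathlib` (D-0151), LEFSCHETZ road B, brick
(W) of B-p15 (g12)'s (B4) PLAN v2 (bus 2026-08-30T08:12:42Z), cut by B-plan1 (g16) 08:13:43Z and ruled a THIN COROLLARY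
08:14:55Z over the two ★ halves:

* ★ `Motives/GeneratingSectionsOfIso` (B-p06 (g12)): transporting a rank-one frame system `F` of `E` along `φ : E ≅ E'`
  (frames `𝒪^{I_x} ≅ E|_{U_x} ≅ E'|_{U_x}`) does not change the coefficients of the sections — `ofFrameSystem_transport`,
  `iSup_basicOpen_coeff_transport`, `ofCocycleSections_transport`;
* ★ `Motives/GeneratingSectionsFrameIndependence` (B-p16 (g15)): for ONE module the datum does not depend on the rank-one frame
  system — `ofCocycleSections_ofFrameSystem_eq`, `iSup_basicOpen_coeff_le_of_rescale`.

[Hartshorne1977] II Thm. 7.1 and its proof: the morphism `X → ℙⁿ` of an invertible sheaf `𝓛` generated by global sections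
`t_0, …, t_n` depends only on the ISOMORPHISM CLASS of the pair `(𝓛, (t_i))`.  Composing the two halves:

* `iSup_basicOpen_coeff_eq_top_of_iso` — generation transports: if the `t_i` generate `E` read in `F`, the `φ(t_i)` generate `E'`
  read in ANY rank-one frame system `F'` of `E'` (the hypothesis `hcov'` below is PRODUCED, not assumed);
* **`ofCocycleSections_ofFrameSystem_eq_of_iso`** — `∃ hcov', ofCocycleSections F.U (ofFrameSystem F h1 t) hcov =
  ofCocycleSections F'.U (ofFrameSystem F' h1' (fun j ↦ φ.hom.app ⊤ (t j))) hcov'` (B-p15's binder `hW` verbatim, with Mathlib's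
  `Scheme.Modules.Hom.app ⊤`);
* `toProj_ofFrameSystem_eq_of_iso` — hence the same morphism `toProj f` to `ℙ(ι)` over any base.

Consumer: (B4) `AbelianVarieties/LefschetzThreeThetaVeryAmple`, END step `h^*𝒪(3Θ₁) ≅ 𝒪(3Θ) ≅ M`.  Count-neutral capital; HC_CM is
proved only modulo the 7 printed citations until rung 0 closes, and this file discharges none of them.

## References
* [Hartshorne1977] R. Hartshorne, *Algebraic Geometry*, GTM 52 (1977), II Thm. 7.1 (p. 150) and its proof.
-/

noncomputable section

universe u

open CategoryTheory AlgebraicGeometry TopologicalSpace Opposite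
open Literature.AlgebraicGeometry.Modules

-- `TopCat.Presheaf`/`Scheme.Modules` are not reducible (as in ★ `Motives/GeneratingSectionsOfLineBundle`).
set_option backward.isDefEq.respectTransparency false

namespace Literature.AlgebraicGeometry.Motives

namespace GeneratingSections

section Iso

variable {X : Scheme.{u}} {E E' : X.Modules} (φ : E ≅ E') (F : FrameSystem E) (F' : FrameSystem E')
  (h1 : ∀ x, F.rank x = 1) (h1' : ∀ x, F'.rank x = 1) {ι : Type} (t : ι → Γ(E, ⊤))

/-- The opens of a frame system cover. [folklore] -/
private theorem iSup_frameSystem_U_eq_top' (G : FrameSystem E') : ⨆ x, G.U x = ⊤ :=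
  eq_top_iff.mpr fun x _ => Opens.mem_iSup.mpr ⟨x, G.mem x⟩

/-- **Generation transports along `φ : E ≅ E'` to ANY rank-one frame system of `E'`**: if the `t_i` generate `E` (the
non-vanishing loci of their coefficients in `F` cover `X`), the `φ(t_i)` generate `E'` read in `F'` — through the transported frame
system `F^φ` (★ `iSup_basicOpen_coeff_transport`) and the frame change `F^φ ⇝ F'` on `E'` (★ `iSup_basicOpen_coeff_le_of_rescale`
with the unit `λ^φ_x(b'_y|)`, ★ `isUnit_coord_basisSection` / `map_coeffAt_eq_coord_mul_map_coeffAt`).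
[cite: Hartshorne1977, II proof of Thm. 7.1] -/
theorem iSup_basicOpen_coeff_eq_top_of_iso
    (hcov : ⨆ i, ⨆ x, X.basicOpen ((CocycleSections.ofFrameSystem F h1 t).coeff i x) = ⊤) :
    ⨆ i, ⨆ x, X.basicOpen ((CocycleSections.ofFrameSystem F' h1' (fun j ↦ φ.hom.app ⊤ (t j))).coeff i x) = ⊤ := by
  -- the transported frame system `F^φ` of `E'` (★ `GeneratingSectionsOfIso`, structure literal, no def)
  let Fφ : FrameSystem E' :=
    { U := F.U, mem := F.mem, I := F.I, rank := F.rank, enum := F.enum,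
      frame := fun x => F.frame x ≪≫ (SheafOfModules.overFunctor _ (F.U x)).mapIso φ }
  have hcovφ : ⨆ i, ⨆ x, X.basicOpen ((CocycleSections.ofFrameSystem Fφ h1 (fun j ↦ φ.hom.app ⊤ (t j))).coeff i x) = ⊤ := by
    rw [iSup_basicOpen_coeff_transport φ F h1 t]; exact hcov
  refine top_le_iff.mp (hcovφ.symm.le.trans (iSup_mono fun i ↦ ?_))
  exact iSup_basicOpen_coeff_le_of_rescale _ _ (iSup_frameSystem_U_eq_top' F')
    (fun x y => coord (Fφ.frame x) (homOfLE (inf_le_left : Fφ.U x ⊓ F'.U y ≤ Fφ.U x))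
      (E'.presheaf.map (homOfLE (inf_le_right : Fφ.U x ⊓ F'.U y ≤ F'.U y)).op
        (basisSection (F'.frame y) (F'.idx h1' y))) (Fφ.idx h1 x))
    (fun x y => isUnit_coord_basisSection Fφ F' h1 h1' x y)
    (fun i x y => map_coeffAt_eq_coord_mul_map_coeffAt Fφ F' h1 h1' (fun j ↦ φ.hom.app ⊤ (t j)) i x y) i

/-- **The generating-sections datum of `(𝓛, t)` sees neither the frames nor an isomorphism of `𝓛`** (Hartshorne II Thm. 7.1:
the morphism to `ℙⁿ` depends only on the isomorphism class of `(𝓛, (t_i))`).  For `φ : E ≅ E'`, rank-one frame systems `F` of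
`E` and `F'` of `E'`, and global sections `t_i` of `E` generating it, the `φ(t_i)` generate `E'` and define, in the frames `F'`,
THE SAME generating-sections datum (opens `X_{t_i}`, ratios `t_j/t_i`) as the `t_i` in the frames `F`: ★
`ofCocycleSections_transport` (`F ⇝ F^φ` along `φ`) followed by ★ `ofCocycleSections_ofFrameSystem_eq` (`F^φ ⇝ F'` on `E'`).
(B-p15 (g12)'s (B4) binder `hW`.) [cite: Hartshorne1977, II Thm. 7.1] -/
theorem ofCocycleSections_ofFrameSystem_eq_of_iso
    (hcov : ⨆ i, ⨆ x, X.basicOpen ((CocycleSections.ofFrameSystem F h1 t).coeff i x) = ⊤) :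
    ∃ hcov' : ⨆ i, ⨆ x, X.basicOpen ((CocycleSections.ofFrameSystem F' h1' (fun j ↦ φ.hom.app ⊤ (t j))).coeff i x) = ⊤,
      ofCocycleSections F.U (CocycleSections.ofFrameSystem F h1 t) hcov =
        ofCocycleSections F'.U (CocycleSections.ofFrameSystem F' h1' (fun j ↦ φ.hom.app ⊤ (t j))) hcov' := by
  let Fφ : FrameSystem E' :=
    { U := F.U, mem := F.mem, I := F.I, rank := F.rank, enum := F.enum,
      frame := fun x => F.frame x ≪≫ (SheafOfModules.overFunctor _ (F.U x)).mapIso φ }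
  have hcovφ : ⨆ i, ⨆ x, X.basicOpen ((CocycleSections.ofFrameSystem Fφ h1 (fun j ↦ φ.hom.app ⊤ (t j))).coeff i x) = ⊤ := by
    rw [iSup_basicOpen_coeff_transport φ F h1 t]; exact hcov
  refine ⟨iSup_basicOpen_coeff_eq_top_of_iso φ F F' h1 h1' t hcov, ?_⟩
  rw [← ofCocycleSections_transport φ F h1 t hcov hcovφ]
  exact ofCocycleSections_ofFrameSystem_eq Fφ F' h1 h1' _ hcovφ _

/-- **The morphism to `ℙ(ι)` of `(𝓛, t)` is invariant under isomorphisms of `𝓛` and changes of frames**: over any base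
`f : X → Spec A`, `toProj f` of the datum of `(E, t)` in `F` equals `toProj f` of the datum of `(E', φ(t))` in `F'`, for any proofs
of the two covering conditions. [cite: Hartshorne1977, II Thm. 7.1] -/
theorem toProj_ofFrameSystem_eq_of_iso [Fintype ι] {A : Type u} [CommRing A] (f : X ⟶ Spec (.of A))
    (hcov : ⨆ i, ⨆ x, X.basicOpen ((CocycleSections.ofFrameSystem F h1 t).coeff i x) = ⊤)
    (hcov' : ⨆ i, ⨆ x, X.basicOpen ((CocycleSections.ofFrameSystem F' h1' (fun j ↦ φ.hom.app ⊤ (t j))).coeff i x) = ⊤) :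
    (ofCocycleSections F.U (CocycleSections.ofFrameSystem F h1 t) hcov).toProj f =
      (ofCocycleSections F'.U (CocycleSections.ofFrameSystem F' h1' (fun j ↦ φ.hom.app ⊤ (t j))) hcov').toProj f := by
  obtain ⟨hcov'', e⟩ := ofCocycleSections_ofFrameSystem_eq_of_iso φ F F' h1 h1' t hcov
  rw [e]

end Iso

end GeneratingSections

end Literature.AlgebraicGeometry.Motives

end
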